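import Summits.HodgeConjecture.HodgeConjecture.Theorems.Ring2AbelianAllUnitaryFivefoldProducts
import Summits.HodgeConjecture.HodgeConjecture.Theorems.Ring2TransportWeilTypeExactness
import Literature.AlgebraicGeometry.HodgeTheory.HodgeConjectureIsogenyInvariance
import Literature.AlgebraicGeometry.Motives.AbelianVarietyPoincareCompleteReducibility
import HarnessLib

/-!
# Ring 2 · AbelianAll (seat `ab-weil-1`, gen 3) — mixed powers ride for free: `E^{a+1} × Y^{b+1}` and all its powers are direct factors of powers of `E × Y`

HONEST FRAMING (sub-cell `pub-hodge-ring2-ab-*`, verbatim): research route, not a corollary; conditional on HC_CM plus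
one named minimal statement. (Cell `pub-hodge-ring2`, verbatim: research route conditional on HC_CM; not a corollary;
Q11.4-sentence-2 already refuted in dim ≥ 3.) `HC_CM` occurs NOWHERE in this file; nothing here is summit progress.

THE POINT (factor descent, kernel-checked, 0 sorry, 0 def). The atlas "power cells" of atlas-1/atlas-2 are typed as HC for the
powers `(E × Y)^{N+1}` (`AbelianVariety.powSucc`). The AV-HODGE-ATLAS rows `g6.E2xY4.(3,1)` (`E_k² × Y₄`), `g7.E3xY4.(3,1)`
(`E_k³ × Y₄`), `g7.E2xY5.(4,1)` / `(3,2)` (`E_k² × Y₅`) — and every power of them — are NOT literally powers of `E × Y`, so weil-1's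
gen-2 carrier map (WEIL1-ATLAS-PASS-G2 §3, edge W13) had to mark their last step "C" (a consequence asserted in prose). This file makes
that step FORMAL: for ANY complex abelian varieties `E, Y` and ANY `a b M : ℕ`,

  `((E^{a+1} × Y^{b+1}))^{M+1}` is a direct factor of `(E × Y)^{K+1}`, `K = (a+b+1)·M + (a+b) + M + 1 ≥ 1`

(product reshuffling isomorphisms in the category `AbelianVariety ℂ`, which has binary products — Literature
`AbelianVariety.prodIsoProd` + Mathlib `prod.braiding/associator/mapIso`), an isomorphism of abelian varieties is an isogeny
(`AbelianVariety.isIsogeny_hom_of_iso`), HC is isogeny-invariant (`HodgeConjectureFor.of_isIsogenous`, van Geemen Lemma 3.7) and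
descends to a factor of a product (`Ring2Transport.hodgeConjectureFor_of_prod`, Fulton Ex. 10.1.2). Hence (§4)

  `(∀ N, HC((E × Y)^{N+1})) ↔ ∀ a b M, HC(((E^{a+1} × Y^{b+1}))^{M+1})`      (`forall_powSucc_prod_iff_mixedPowers`)

and the `0 < N` restriction in atlas-1's cell is immaterial (`forall_powSucc_prod_pos_iff`). §5 instantiates this on the two typed
cells `Ring2.Atlas.HodgePowersOfEllipticTimesFourfold13` (atlas-1, p-OpenCells) and `Ring2.Atlas.HodgePowersOfCMEllipticTimesUnitaryFivefold`
(atlas-2), and through weil-2's suppliers with NAMED PRICES (`hodgePowersOfEllipticTimesFourfold13_of_markmanSixfolds_of_weilSeeded`,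
Koike `d = 1` / Schoen `d = 3` REFEREED slices, `hodgePowersOfCMEllipticTimesUnitaryFivefold_of_sixfolds_of_eightfolds_of_seeded`): the rows
above become kernel consequences of exactly the same binders (`hM`/`hK`/`hS` + `hR4`; `h6` + `h8` + `hR5`), with no new hypothesis and no
new open statement. ON-PATH: every statement here is a case of `HC_AV` (§6).

## References
* [vanGeemen1994HodgeAV] B. van Geemen, An introduction to the Hodge conjecture for abelian varieties, LNM 1594 (1994), Lemma 3.7.
* [Fulton1998] W. Fulton, Intersection Theory, 2nd ed. (1998), §10.1 Example 10.1.2 (exterior products of cycles).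
* [MumfordAV1970] D. Mumford, Abelian Varieties (1970), §4 (products), §19.
* [MoonenZarhin1999LowDim] B. Moonen, Yu. Zarhin, Math. Ann. 315 (1999), §5. [Markman2025SecantWeil] arXiv:2502.03415 Thm. 1.5.1 (UNREFEREED).
* [Koike2004WeilHodge] Cor. 2.1. [Schoen1998HodgeWeilAddendum]. [Deligne2000] §1.
-/

set_option linter.dupNamespace false

noncomputable section

open CategoryTheory

namespace Summit.HodgeConjecture.HodgeConjecture.Ring2.AbelianAll

open Literature.AlgebraicGeometry Literature.AlgebraicGeometry.Motives
open Literature.AlgebraicGeometry.HodgeTheory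
open Summit.HodgeConjecture.HodgeConjecture.Theses
open Summit.HodgeConjecture.HodgeConjecture.WeilTypeLadder

universe u

section ProductIsos

variable {k : Type u} [Field k]

/-! ## §1 Product reshuffling in `AbelianVariety k` (isomorphisms, recorded as `Nonempty` facts — no new definitions) -/

/-- `A × B ≅ B × A` (the braiding of the categorical product, moved to `AbelianVariety.prod` along `prodIsoProd`). [folklore]
[cite: MumfordAV1970, §4] -/
theorem nonempty_prod_comm_iso (A B : AbelianVariety k) : Nonempty (A.prod B ≅ B.prod A) :=
  ⟨(AbelianVariety.prodIsoProd A B).symm ≪≫ Limits.prod.braiding A B ≪≫ AbelianVariety.prodIsoProd B A⟩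

/-- `A ≅ A'`, `B ≅ B'` give `A × B ≅ A' × B'`. [folklore] [cite: MumfordAV1970, §4] -/
theorem nonempty_prod_congr_iso {A A' B B' : AbelianVariety k} (e : A ≅ A') (f : B ≅ B') :
    Nonempty (A.prod B ≅ A'.prod B') :=
  ⟨(AbelianVariety.prodIsoProd A B).symm ≪≫ Limits.prod.mapIso e f ≪≫ AbelianVariety.prodIsoProd A' B'⟩

/-- `(A × B) × C ≅ A × (B × C)` (the associator of the categorical product). [folklore] [cite: MumfordAV1970, §4] -/
theorem nonempty_prod_assoc_iso (A B C : AbelianVariety k) :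
    Nonempty ((A.prod B).prod C ≅ A.prod (B.prod C)) :=
  ⟨(AbelianVariety.prodIsoProd (A.prod B) C).symm ≪≫
    Limits.prod.mapIso (AbelianVariety.prodIsoProd A B).symm (Iso.refl C) ≪≫
    Limits.prod.associator A B C ≪≫
    Limits.prod.mapIso (Iso.refl A) (AbelianVariety.prodIsoProd B C) ≪≫
    AbelianVariety.prodIsoProd A (B.prod C)⟩

/-- The interchange isomorphism `(A × B) × (C × D) ≅ (A × C) × (B × D)`. [folklore] [cite: MumfordAV1970, §4] -/
theorem nonempty_prod_interchange_iso (A B C D : AbelianVariety k) :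
    Nonempty ((A.prod B).prod (C.prod D) ≅ (A.prod C).prod (B.prod D)) := by
  obtain ⟨e₁⟩ := nonempty_prod_assoc_iso A B (C.prod D)
  obtain ⟨e₂⟩ := nonempty_prod_assoc_iso B C D
  obtain ⟨e₃⟩ := nonempty_prod_comm_iso B C
  obtain ⟨e₄⟩ := nonempty_prod_congr_iso e₃ (Iso.refl D)
  obtain ⟨e₅⟩ := nonempty_prod_assoc_iso C B D
  obtain ⟨e₆⟩ := nonempty_prod_congr_iso (Iso.refl A) (e₂.symm ≪≫ e₄ ≪≫ e₅)
  obtain ⟨e₇⟩ := nonempty_prod_assoc_iso A C (B.prod D)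
  exact ⟨e₁ ≪≫ e₆ ≪≫ e₇.symm⟩

/-- **Powers add**: `Z^{m+n+2} ≅ Z^{m+1} × Z^{n+1}`, i.e. `Z.powSucc (m + n + 1) ≅ Z.powSucc m × Z.powSucc n`
(`powSucc (n+1) = powSucc n × Z` and the associator). [folklore] [cite: LiOort1998, §0.1] -/
theorem nonempty_powSucc_add_iso (Z : AbelianVariety k) (m : ℕ) :
    ∀ n : ℕ, Nonempty (Z.powSucc (m + n + 1) ≅ (Z.powSucc m).prod (Z.powSucc n))
  | 0 => ⟨Iso.refl _⟩
  | n + 1 => by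
    obtain ⟨e⟩ := nonempty_powSucc_add_iso Z m n
    obtain ⟨e₁⟩ := nonempty_prod_congr_iso e (Iso.refl Z)
    obtain ⟨e₂⟩ := nonempty_prod_assoc_iso (Z.powSucc m) (Z.powSucc n) Z
    exact ⟨e₁ ≪≫ e₂⟩

/-- **Powers multiply**: `(Z^{n+1})^{M+1} ≅ Z^{(n+1)(M+1)}`, i.e. `(Z.powSucc n).powSucc M ≅ Z.powSucc (n * M + n + M)`.
[folklore] [cite: LiOort1998, §0.1] -/
theorem nonempty_powSucc_powSucc_iso (Z : AbelianVariety k) (n : ℕ) :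
    ∀ M : ℕ, Nonempty ((Z.powSucc n).powSucc M ≅ Z.powSucc (n * M + n + M))
  | 0 => ⟨eqToIso (by simp)⟩
  | M + 1 => by
    obtain ⟨e⟩ := nonempty_powSucc_powSucc_iso Z n M
    obtain ⟨e₁⟩ := nonempty_prod_congr_iso e (Iso.refl (Z.powSucc n))
    obtain ⟨e₂⟩ := nonempty_powSucc_add_iso Z (n * M + n + M) n
    have h : n * M + n + M + n + 1 = n * (M + 1) + n + (M + 1) := by ring
    exact ⟨e₁ ≪≫ e₂.symm ≪≫ eqToIso (congrArg Z.powSucc h)⟩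

/-! ## §2 Direct factors: `W ∣ Z` means `∃ C, Z ≅ W × C` (spelled out; no new definition) -/

/-- `W ∣ W × C`. [folklore] [cite: MumfordAV1970, §4] -/
theorem factor_prod_left (W C : AbelianVariety k) : ∃ C' : AbelianVariety k, Nonempty (W.prod C ≅ W.prod C') :=
  ⟨C, ⟨Iso.refl _⟩⟩

/-- `W ∣ C × W`. [folklore] [cite: MumfordAV1970, §4] -/
theorem factor_prod_right (C W : AbelianVariety k) : ∃ C' : AbelianVariety k, Nonempty (C.prod W ≅ W.prod C') :=
  ⟨C, nonempty_prod_comm_iso C W⟩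

/-- `Z' ≅ Z` and `W ∣ Z` give `W ∣ Z'`. [folklore] [cite: MumfordAV1970, §4] -/
theorem factor_of_iso {W Z Z' : AbelianVariety k} (e : Nonempty (Z' ≅ Z))
    (h : ∃ C : AbelianVariety k, Nonempty (Z ≅ W.prod C)) : ∃ C : AbelianVariety k, Nonempty (Z' ≅ W.prod C) := by
  obtain ⟨e⟩ := e
  obtain ⟨C, ⟨f⟩⟩ := h
  exact ⟨C, ⟨e ≪≫ f⟩⟩

/-- `W₁ ∣ Z₁` and `W₂ ∣ Z₂` give `W₁ × W₂ ∣ Z₁ × Z₂` (interchange). [folklore] [cite: MumfordAV1970, §4] -/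
theorem factor_prod_prod {W₁ Z₁ W₂ Z₂ : AbelianVariety k} (h₁ : ∃ C : AbelianVariety k, Nonempty (Z₁ ≅ W₁.prod C))
    (h₂ : ∃ C : AbelianVariety k, Nonempty (Z₂ ≅ W₂.prod C)) :
    ∃ C : AbelianVariety k, Nonempty (Z₁.prod Z₂ ≅ (W₁.prod W₂).prod C) := by
  obtain ⟨C₁, ⟨e₁⟩⟩ := h₁
  obtain ⟨C₂, ⟨e₂⟩⟩ := h₂
  obtain ⟨e⟩ := nonempty_prod_congr_iso e₁ e₂
  obtain ⟨e'⟩ := nonempty_prod_interchange_iso W₁ C₁ W₂ C₂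
  exact ⟨C₁.prod C₂, ⟨e ≪≫ e'⟩⟩

/-- `W ∣ Z` gives `W^{M+1} ∣ Z^{M+1}`. [folklore] [cite: MumfordAV1970, §4] -/
theorem factor_powSucc {W Z : AbelianVariety k} (h : ∃ C : AbelianVariety k, Nonempty (Z ≅ W.prod C)) :
    ∀ M : ℕ, ∃ C : AbelianVariety k, Nonempty (Z.powSucc M ≅ (W.powSucc M).prod C)
  | 0 => h
  | M + 1 => factor_prod_prod (factor_powSucc h M) h

/-- **The mixed-power factor.** For any `E, Y` and `a b M : ℕ`: `((E^{a+1} × Y^{b+1}))^{M+1} ∣ (E × Y)^{K+1}` with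
`K = (a+b+1)·M + (a+b) + M + 1` (so `K + 1 = (a+b+2)(M+1)`): `E^{a+1} ∣ (E×Y)^{a+1}`, `Y^{b+1} ∣ (E×Y)^{b+1}`, multiply, use
`(E×Y)^{a+b+2} ≅ (E×Y)^{a+1} × (E×Y)^{b+1}`, raise to the `(M+1)`-st power and use `((E×Y)^{a+b+2})^{M+1} ≅ (E×Y)^{(a+b+2)(M+1)}`.
[folklore] [cite: MumfordAV1970, §4] -/
theorem factor_mixedPowers (E Y : AbelianVariety k) (a b M : ℕ) :
    ∃ C : AbelianVariety k, Nonempty ((E.prod Y).powSucc ((a + b + 1) * M + (a + b) + M + 1) ≅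
      (((E.powSucc a).prod (Y.powSucc b)).powSucc M).prod C) := by
  have hE : ∃ C : AbelianVariety k, Nonempty (E.prod Y ≅ E.prod C) := factor_prod_left E Y
  have hY : ∃ C : AbelianVariety k, Nonempty (E.prod Y ≅ Y.prod C) := factor_prod_right E Y
  have h₁ : ∃ C : AbelianVariety k, Nonempty (((E.prod Y).powSucc a).prod ((E.prod Y).powSucc b) ≅
      ((E.powSucc a).prod (Y.powSucc b)).prod C) :=
    factor_prod_prod (factor_powSucc hE a) (factor_powSucc hY b)
  have h₂ : ∃ C : AbelianVariety k, Nonempty ((E.prod Y).powSucc (a + b + 1) ≅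
      ((E.powSucc a).prod (Y.powSucc b)).prod C) :=
    factor_of_iso (nonempty_powSucc_add_iso (E.prod Y) a b) h₁
  have h₃ : ∃ C : AbelianVariety k, Nonempty (((E.prod Y).powSucc (a + b + 1)).powSucc M ≅
      (((E.powSucc a).prod (Y.powSucc b)).powSucc M).prod C) :=
    factor_powSucc h₂ M
  have h₄ : Nonempty ((E.prod Y).powSucc ((a + b + 1) * M + (a + b) + M + 1) ≅
      ((E.prod Y).powSucc (a + b + 1)).powSucc M) := by
    obtain ⟨e⟩ := nonempty_powSucc_powSucc_iso (E.prod Y) (a + b + 1) M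
    have hK : (a + b + 1) * M + (a + b) + M + 1 = (a + b + 1) * M + (a + b + 1) + M := by ring
    exact ⟨eqToIso (congrArg (E.prod Y).powSucc hK) ≪≫ e.symm⟩
  exact factor_of_iso h₄ h₃

end ProductIsos

/-! ## §3 HC along isomorphisms and down to direct factors (complex abelian varieties) -/

/-- HC transports along an isomorphism of complex abelian varieties (an isomorphism is an isogeny; van Geemen Lemma 3.7).
[cite: vanGeemen1994HodgeAV, Lemma 3.7] -/
theorem hodgeConjectureFor_of_iso_abelianVariety {A B : AbelianVariety ℂ} (e : A ≅ B)
    (h : HodgeConjectureFor B.dim B.X) : HodgeConjectureFor A.dim A.X :=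
  HodgeConjectureFor.of_isIsogenous ⟨e.hom, AbelianVariety.isIsogeny_hom_of_iso e⟩ h

/-- **HC descends to a direct factor**: `Z ≅ W × C` and `HC(Z)` (all degrees) give `HC(W)` (all degrees) — `pr_W^*` is injective on
cohomology with left inverse `i_W^*`, both algebraic. [cite: Fulton1998, §10.1 Example 10.1.2] [cite: vanGeemen1994HodgeAV, Lemma 3.7] -/
theorem hodgeConjectureFor_of_factor {W Z : AbelianVariety ℂ} (hWZ : ∃ C : AbelianVariety ℂ, Nonempty (Z ≅ W.prod C))
    (h : HodgeConjectureFor Z.dim Z.X) : HodgeConjectureFor W.dim W.X := by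
  obtain ⟨C, ⟨e⟩⟩ := hWZ
  exact Ring2Transport.hodgeConjectureFor_of_prod W C (hodgeConjectureFor_of_iso_abelianVariety e.symm h)

/-! ## §4 Mixed powers ride for free -/

/-- **MIXED POWERS RIDE FOR FREE.** If HC holds for every power `(E × Y)^{N+1}`, `N ≥ 1`, then HC holds for
`((E^{a+1} × Y^{b+1}))^{M+1}` for all `a b M : ℕ` (a direct factor of `(E × Y)^{K+1}`, `K = (a+b+1)M + (a+b) + M + 1 ≥ 1`).
[cite: Fulton1998, §10.1 Example 10.1.2] [cite: vanGeemen1994HodgeAV, Lemma 3.7] -/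
theorem hodgeConjectureFor_mixedPowers_of_forall_powSucc_prod (E Y : AbelianVariety ℂ)
    (h : ∀ N : ℕ, 0 < N → HodgeConjectureFor ((E.prod Y).powSucc N).dim ((E.prod Y).powSucc N).X) (a b M : ℕ) :
    HodgeConjectureFor (((E.powSucc a).prod (Y.powSucc b)).powSucc M).dim
      (((E.powSucc a).prod (Y.powSucc b)).powSucc M).X :=
  hodgeConjectureFor_of_factor (factor_mixedPowers E Y a b M) (h _ (Nat.succ_pos _))

/-- In particular the `0 < N` restriction of a power cell is immaterial: `HC((E × Y)^{N+1})` for all `N ≥ 1` already gives it for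
`N = 0` (`E × Y ∣ (E × Y)²`). [cite: Fulton1998, §10.1 Example 10.1.2] -/
theorem forall_powSucc_prod_pos_iff (E Y : AbelianVariety ℂ) :
    (∀ N : ℕ, 0 < N → HodgeConjectureFor ((E.prod Y).powSucc N).dim ((E.prod Y).powSucc N).X) ↔
      ∀ N : ℕ, HodgeConjectureFor ((E.prod Y).powSucc N).dim ((E.prod Y).powSucc N).X :=
  ⟨fun h N ↦ hodgeConjectureFor_mixedPowers_of_forall_powSucc_prod E Y h 0 0 N, fun h N _ ↦ h N⟩

/-- **The power cell and the mixed-power family are the SAME statement**: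
`(∀ N, HC((E × Y)^{N+1})) ↔ ∀ a b M, HC(((E^{a+1} × Y^{b+1}))^{M+1})` (`←`: `a = b = 0`).
[cite: Fulton1998, §10.1 Example 10.1.2] [cite: vanGeemen1994HodgeAV, Lemma 3.7] -/
theorem forall_powSucc_prod_iff_mixedPowers (E Y : AbelianVariety ℂ) :
    (∀ N : ℕ, HodgeConjectureFor ((E.prod Y).powSucc N).dim ((E.prod Y).powSucc N).X) ↔
      ∀ a b M : ℕ, HodgeConjectureFor (((E.powSucc a).prod (Y.powSucc b)).powSucc M).dim
        (((E.powSucc a).prod (Y.powSucc b)).powSucc M).X :=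
  ⟨fun h a b M ↦ hodgeConjectureFor_mixedPowers_of_forall_powSucc_prod E Y (fun N _ ↦ h N) a b M,
    fun h N ↦ h 0 0 N⟩

/-- `W ≅ W'` gives `W^{M+1} ≅ W'^{M+1}`. [folklore] [cite: MumfordAV1970, §4] -/
theorem nonempty_powSucc_congr_iso {k : Type u} [Field k] {W W' : AbelianVariety k} (e : W ≅ W') :
    ∀ M : ℕ, Nonempty (W.powSucc M ≅ W'.powSucc M)
  | 0 => ⟨e⟩
  | M + 1 => by
    obtain ⟨f⟩ := nonempty_powSucc_congr_iso e M
    exact nonempty_prod_congr_iso f e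

/-- The symmetric family `((Y^{b+1} × E^{a+1}))^{M+1}` rides too (it is isomorphic to `((E^{a+1} × Y^{b+1}))^{M+1}`).
[cite: Fulton1998, §10.1 Example 10.1.2] [cite: vanGeemen1994HodgeAV, Lemma 3.7] -/
theorem hodgeConjectureFor_mixedPowers_symm_of_forall_powSucc_prod (E Y : AbelianVariety ℂ)
    (h : ∀ N : ℕ, 0 < N → HodgeConjectureFor ((E.prod Y).powSucc N).dim ((E.prod Y).powSucc N).X) (a b M : ℕ) :
    HodgeConjectureFor (((Y.powSucc b).prod (E.powSucc a)).powSucc M).dim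
      (((Y.powSucc b).prod (E.powSucc a)).powSucc M).X := by
  obtain ⟨e⟩ := nonempty_prod_comm_iso (Y.powSucc b) (E.powSucc a)
  obtain ⟨f⟩ := nonempty_powSucc_congr_iso e M
  exact hodgeConjectureFor_of_iso_abelianVariety f (hodgeConjectureFor_mixedPowers_of_forall_powSucc_prod E Y h a b M)

/-! ## §5 The atlas rows `E_k² × Y₄`, `E_k³ × Y₄`, `E_k² × Y₅` (and all their powers) as kernel consequences of the typed power cells

`E.powSucc 1 = E × E` and `E.powSucc 2 = (E × E) × E` definitionally, so the rows are the instances `(a, b) = (1, 0)`, `(2, 0)` of §4. -/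

/-- **Cell `HodgePowersOfEllipticTimesFourfold13` (atlas-1) ⇒ every mixed power `((E^{a+1} × Y^{b+1}))^{M+1}`** of its members
(`E` elliptic with `φ² = -d`, `Y` a simple fourfold with `ψ² = -d` of `k`-multiplicity `(1,3)`/`(3,1)`).
[cite: MoonenZarhin1999LowDim, §5 Case 2] [cite: Fulton1998, §10.1 Example 10.1.2] -/
theorem hodgeConjectureFor_mixedPowers_of_hodgePowersOfEllipticTimesFourfold13
    (h : Ring2.Atlas.HodgePowersOfEllipticTimesFourfold13)
    (E Y : AbelianVariety ℂ) (φ : E ⟶ E) (ψ : Y ⟶ Y) (d : ℕ) (hd : 0 < d) (hE : E.dim = 1) (hY : Y.dim = 4)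
    (hYs : Y.IsSimple) (hφ : φ ≫ φ = -(d • 𝟙 E)) (hψ : ψ ≫ ψ = -(d • 𝟙 Y))
    (hm : HodgeTheory.eigenMultiplicity Y ψ (Complex.I * (Real.sqrt d : ℂ)) = 1 ∨
      HodgeTheory.eigenMultiplicity Y ψ (-(Complex.I * (Real.sqrt d : ℂ))) = 1)
    (a b M : ℕ) :
    HodgeConjectureFor (((E.powSucc a).prod (Y.powSucc b)).powSucc M).dim
      (((E.powSucc a).prod (Y.powSucc b)).powSucc M).X :=
  hodgeConjectureFor_mixedPowers_of_forall_powSucc_prod E Y (h E Y φ ψ d hd hE hY hYs hφ hψ hm) a b M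

/-- **Row `g6.E2xY4.(3,1)` of AV-HODGE-ATLAS and all its powers** — `HC(((E × E) × Y)^{M+1})` — from the atlas-1 power cell.
[cite: MoonenZarhin1999LowDim, §5 Case 2] [cite: Fulton1998, §10.1 Example 10.1.2] -/
theorem hodgeConjectureFor_powSucc_E2xY4_of_hodgePowersOfEllipticTimesFourfold13
    (h : Ring2.Atlas.HodgePowersOfEllipticTimesFourfold13)
    (E Y : AbelianVariety ℂ) (φ : E ⟶ E) (ψ : Y ⟶ Y) (d : ℕ) (hd : 0 < d) (hE : E.dim = 1) (hY : Y.dim = 4)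
    (hYs : Y.IsSimple) (hφ : φ ≫ φ = -(d • 𝟙 E)) (hψ : ψ ≫ ψ = -(d • 𝟙 Y))
    (hm : HodgeTheory.eigenMultiplicity Y ψ (Complex.I * (Real.sqrt d : ℂ)) = 1 ∨
      HodgeTheory.eigenMultiplicity Y ψ (-(Complex.I * (Real.sqrt d : ℂ))) = 1)
    (M : ℕ) :
    HodgeConjectureFor ((((E.prod E).prod Y)).powSucc M).dim ((((E.prod E).prod Y)).powSucc M).X :=
  hodgeConjectureFor_mixedPowers_of_hodgePowersOfEllipticTimesFourfold13 h E Y φ ψ d hd hE hY hYs hφ hψ hm 1 0 M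

/-- **Row `g7.E3xY4.(3,1)` of AV-HODGE-ATLAS and all its powers** — `HC((((E × E) × E) × Y)^{M+1})` — from the atlas-1 power cell.
[cite: MoonenZarhin1999LowDim, §5 Case 2] [cite: Fulton1998, §10.1 Example 10.1.2] -/
theorem hodgeConjectureFor_powSucc_E3xY4_of_hodgePowersOfEllipticTimesFourfold13
    (h : Ring2.Atlas.HodgePowersOfEllipticTimesFourfold13)
    (E Y : AbelianVariety ℂ) (φ : E ⟶ E) (ψ : Y ⟶ Y) (d : ℕ) (hd : 0 < d) (hE : E.dim = 1) (hY : Y.dim = 4)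
    (hYs : Y.IsSimple) (hφ : φ ≫ φ = -(d • 𝟙 E)) (hψ : ψ ≫ ψ = -(d • 𝟙 Y))
    (hm : HodgeTheory.eigenMultiplicity Y ψ (Complex.I * (Real.sqrt d : ℂ)) = 1 ∨
      HodgeTheory.eigenMultiplicity Y ψ (-(Complex.I * (Real.sqrt d : ℂ))) = 1)
    (M : ℕ) :
    HodgeConjectureFor (((((E.prod E).prod E).prod Y)).powSucc M).dim (((((E.prod E).prod E).prod Y)).powSucc M).X :=
  hodgeConjectureFor_mixedPowers_of_hodgePowersOfEllipticTimesFourfold13 h E Y φ ψ d hd hE hY hYs hφ hψ hm 2 0 M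

/-- **Every mixed power of the `E_k × Y₄` cell with weil-2's NAMED PRICES, every `k`**: Markman's hyperbolic Weil sixfolds (binder `hM`,
UNREFEREED arXiv:2502.03415 Thm. 1.5.1) and the typed member shape R4 (`hR4`); `HC_CM` ABSENT.
[cite: Markman2025SecantWeil, Thm. 1.5.1] [cite: MoonenZarhin1999LowDim, §5 Case 2] -/
theorem hodgeConjectureFor_mixedPowers_ellipticTimesFourfold13_of_markmanSixfolds_of_weilSeeded
    (hM : Markman2025_weilClasses_algebraic_hyperbolicSixfold) (hR4 : EllipticTimesFourfold13WeilSeeded)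
    (E Y : AbelianVariety ℂ) (φ : E ⟶ E) (ψ : Y ⟶ Y) (d : ℕ) (hd : 0 < d) (hE : E.dim = 1) (hY : Y.dim = 4)
    (hYs : Y.IsSimple) (hφ : φ ≫ φ = -(d • 𝟙 E)) (hψ : ψ ≫ ψ = -(d • 𝟙 Y))
    (hm : HodgeTheory.eigenMultiplicity Y ψ (Complex.I * (Real.sqrt d : ℂ)) = 1 ∨
      HodgeTheory.eigenMultiplicity Y ψ (-(Complex.I * (Real.sqrt d : ℂ))) = 1)
    (a b M : ℕ) :
    HodgeConjectureFor (((E.powSucc a).prod (Y.powSucc b)).powSucc M).dim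
      (((E.powSucc a).prod (Y.powSucc b)).powSucc M).X :=
  hodgeConjectureFor_mixedPowers_of_hodgePowersOfEllipticTimesFourfold13
    (hodgePowersOfEllipticTimesFourfold13_of_markmanSixfolds_of_weilSeeded hM hR4) E Y φ ψ d hd hE hY hYs hφ hψ hm a b M

/-- **Every mixed power of the `k = ℚ(i)` sub-cell from REFEREED print** (Koike 2004 Cor. 2.1) and R4 — in particular rows
`g6.E2xY4.(3,1)`, `g7.E3xY4.(3,1)` at `k = ℚ(i)` WITHOUT `HC_CM` and without Markman.
[cite: Koike2004WeilHodge, Cor. 2.1] [cite: MoonenZarhin1999LowDim, §5 Case 2] -/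
theorem hodgeConjectureFor_mixedPowers_ellipticTimesFourfold13_of_koike_of_weilSeeded
    (hK : Koike2004_weilClasses_algebraic_hyperbolicSixfold_one) (hR4 : EllipticTimesFourfold13WeilSeeded)
    (E Y : AbelianVariety ℂ) (φ : E ⟶ E) (ψ : Y ⟶ Y) (hE : E.dim = 1) (hY : Y.dim = 4) (hYs : Y.IsSimple)
    (hφ : φ ≫ φ = -((1 : ℕ) • 𝟙 E)) (hψ : ψ ≫ ψ = -((1 : ℕ) • 𝟙 Y))
    (hm : HodgeTheory.eigenMultiplicity Y ψ (Complex.I * (Real.sqrt (1 : ℕ) : ℂ)) = 1 ∨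
      HodgeTheory.eigenMultiplicity Y ψ (-(Complex.I * (Real.sqrt (1 : ℕ) : ℂ))) = 1)
    (a b M : ℕ) :
    HodgeConjectureFor (((E.powSucc a).prod (Y.powSucc b)).powSucc M).dim
      (((E.powSucc a).prod (Y.powSucc b)).powSucc M).X :=
  hodgeConjectureFor_mixedPowers_of_forall_powSucc_prod E Y
    (fun N _ ↦ hodgeConjectureFor_powSucc_ellipticTimesFourfold13_of_koike_of_weilSeeded hK hR4 E Y φ ψ hE hY hYs hφ hψ hm N)
    a b M

/-- **Every mixed power of the `k = ℚ(√-3)` sub-cell from REFEREED print** (Schoen 1988/1998) and R4, WITHOUT `HC_CM` and without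
Markman. [cite: Schoen1998HodgeWeilAddendum] [cite: Schoen1988HodgeWeil] [cite: MoonenZarhin1999LowDim, §5 Case 2] -/
theorem hodgeConjectureFor_mixedPowers_ellipticTimesFourfold13_of_schoen_of_weilSeeded
    (hS : Schoen1998_weilClasses_algebraic_hyperbolicSixfold_three) (hR4 : EllipticTimesFourfold13WeilSeeded)
    (E Y : AbelianVariety ℂ) (φ : E ⟶ E) (ψ : Y ⟶ Y) (hE : E.dim = 1) (hY : Y.dim = 4) (hYs : Y.IsSimple)
    (hφ : φ ≫ φ = -((3 : ℕ) • 𝟙 E)) (hψ : ψ ≫ ψ = -((3 : ℕ) • 𝟙 Y))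
    (hm : HodgeTheory.eigenMultiplicity Y ψ (Complex.I * (Real.sqrt (3 : ℕ) : ℂ)) = 1 ∨
      HodgeTheory.eigenMultiplicity Y ψ (-(Complex.I * (Real.sqrt (3 : ℕ) : ℂ))) = 1)
    (a b M : ℕ) :
    HodgeConjectureFor (((E.powSucc a).prod (Y.powSucc b)).powSucc M).dim
      (((E.powSucc a).prod (Y.powSucc b)).powSucc M).X :=
  hodgeConjectureFor_mixedPowers_of_forall_powSucc_prod E Y
    (fun N _ ↦ hodgeConjectureFor_powSucc_ellipticTimesFourfold13_of_schoen_of_weilSeeded hS hR4 E Y φ ψ hE hY hYs hφ hψ hm N)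
    a b M

/-- **Cell `HodgePowersOfCMEllipticTimesUnitaryFivefold` (atlas-2) ⇒ every mixed power `((E^{a+1} × Y^{b+1}))^{M+1}`** of its
members (`E` elliptic with `φ² = -d`, `Y` a simple FIVEFOLD with `ψ² = -d`; both `k`-signatures `(3,2)` and `(4,1)`).
[cite: MoonenZarhin1999LowDim, §3 (3.8)] [cite: Fulton1998, §10.1 Example 10.1.2] -/
theorem hodgeConjectureFor_mixedPowers_of_hodgePowersOfCMEllipticTimesUnitaryFivefold
    (h : Ring2.Atlas.HodgePowersOfCMEllipticTimesUnitaryFivefold)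
    (E Y : AbelianVariety ℂ) (φ : E ⟶ E) (ψ : Y ⟶ Y) (d : ℕ) (hd : 0 < d) (hE : E.dim = 1) (hY : Y.dim = 5)
    (hYs : Y.IsSimple) (hφ : φ ≫ φ = -(d • 𝟙 E)) (hψ : ψ ≫ ψ = -(d • 𝟙 Y)) (a b M : ℕ) :
    HodgeConjectureFor (((E.powSucc a).prod (Y.powSucc b)).powSucc M).dim
      (((E.powSucc a).prod (Y.powSucc b)).powSucc M).X :=
  hodgeConjectureFor_mixedPowers_of_forall_powSucc_prod E Y (fun N _ ↦ h E Y φ ψ d hd hE hY hYs hφ hψ N) a b M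

/-- **Rows `g7.E2xY5.(4,1)` / `g7.E2xY5.(3,2)` of AV-HODGE-ATLAS and all their powers** — `HC(((E × E) × Y₅)^{M+1})` — from the
atlas-2 power cell. [cite: MoonenZarhin1999LowDim, §3 (3.8)] [cite: Fulton1998, §10.1 Example 10.1.2] -/
theorem hodgeConjectureFor_powSucc_E2xY5_of_hodgePowersOfCMEllipticTimesUnitaryFivefold
    (h : Ring2.Atlas.HodgePowersOfCMEllipticTimesUnitaryFivefold)
    (E Y : AbelianVariety ℂ) (φ : E ⟶ E) (ψ : Y ⟶ Y) (d : ℕ) (hd : 0 < d) (hE : E.dim = 1) (hY : Y.dim = 5)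
    (hYs : Y.IsSimple) (hφ : φ ≫ φ = -(d • 𝟙 E)) (hψ : ψ ≫ ψ = -(d • 𝟙 Y)) (M : ℕ) :
    HodgeConjectureFor ((((E.prod E).prod Y)).powSucc M).dim ((((E.prod E).prod Y)).powSucc M).X :=
  hodgeConjectureFor_mixedPowers_of_hodgePowersOfCMEllipticTimesUnitaryFivefold h E Y φ ψ d hd hE hY hYs hφ hψ 1 0 M

/-- **Every mixed power of the `E_k × Y₅` cell with weil-2's TWO NAMED PRICES** — hyperbolic Weil sixfolds (`h6`, Markman Thm. 1.5.1,
UNREFEREED) and hyperbolic Weil EIGHTFOLDS (`h8 : WeilTypeLadder.SplitEightfolds`, OPEN in print) — plus the typed member shape R5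
(`hR5`); `HC_CM` ABSENT. In particular row `g7.E2xY5.(4,1)` and its powers sit behind exactly `h6 + h8 + hR5`.
[cite: Markman2025SecantWeil, Thm. 1.5.1] [cite: MoonenZarhin1999LowDim, §3 (3.8)] -/
theorem hodgeConjectureFor_mixedPowers_unitaryFivefold_of_sixfolds_of_eightfolds_of_seeded
    (h6 : Markman2025_weilClasses_algebraic_hyperbolicSixfold) (h8 : SplitEightfolds)
    (hR5 : UnitaryFivefoldProductWeilSeeded)
    (E Y : AbelianVariety ℂ) (φ : E ⟶ E) (ψ : Y ⟶ Y) (d : ℕ) (hd : 0 < d) (hE : E.dim = 1) (hY : Y.dim = 5)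
    (hYs : Y.IsSimple) (hφ : φ ≫ φ = -(d • 𝟙 E)) (hψ : ψ ≫ ψ = -(d • 𝟙 Y)) (a b M : ℕ) :
    HodgeConjectureFor (((E.powSucc a).prod (Y.powSucc b)).powSucc M).dim
      (((E.powSucc a).prod (Y.powSucc b)).powSucc M).X :=
  hodgeConjectureFor_mixedPowers_of_hodgePowersOfCMEllipticTimesUnitaryFivefold
    (hodgePowersOfCMEllipticTimesUnitaryFivefold_of_sixfolds_of_eightfolds_of_seeded h6 h8 hR5)
    E Y φ ψ d hd hE hY hYs hφ hψ a b M

/-! ## §6 ON-PATH -/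

/-- ON-PATH: every mixed power is a case of `HC_AV` (so nothing in this file is summit progress; it only moves atlas rows INSIDE
already-typed cells). [cite: Deligne2000, §1] -/
theorem hodgeConjectureFor_mixedPowers_of_hodgeAbelianVarieties (h : PadicSemiregularLift.HodgeAbelianVarieties)
    (E Y : AbelianVariety ℂ) (a b M : ℕ) :
    HodgeConjectureFor (((E.powSucc a).prod (Y.powSucc b)).powSucc M).dim
      (((E.powSucc a).prod (Y.powSucc b)).powSucc M).X :=
  h _

end Summit.HodgeConjecture.HodgeConjecture.Ring2.AbelianAll

end
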